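import Literature.Computability.Complexity.ACFourierTails
import Literature.Computability.Complexity.TC0SubsetNC1Reduction
import HarnessLib

/-!
# Crux `MobiusLadder.LiouvilleOrthogonalTC0` (stmt-QuantumAdvantage-1393), line `Sketch`, skeleton v11:
stub `stub_majTop` (T5) — a single majority gate at the top is a threshold of `AC⁰` sub-circuits

SYNTACTIC bridge of the threshold-of-`AC⁰` rung. Let `C` be a circuit on the `n` binary digits over
`tcBasis = {¬} ∪ {∧ₖ, ∨ₖ, MAJₖ : k ∈ ℕ}` (gates in topological order) all of whose gates except possibly
the LAST one are in `acBasis = {¬} ∪ {∧ₖ, ∨ₖ : k ∈ ℕ}`. Then `C` computes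
`x ↦ b ⊕ [θ ≤ Σ_a w_a · C_a(x)]` for at most `size C + n` circuits `C_a` over `acBasis`, each of
`acDepth ≤ acDepth C` and `size ≤ size C`, with real weights `w_a`, a real threshold `θ` and `b = false`.

Proof (case analysis on the output wire `C.output` and the gate it names).

* `C.output = inl i` (an input): `C(x) = x i = [1 ≤ 1 · x_i]`, one circuit `Circuit.input i`
  (no gates), and `1 ≤ size C + n` because `i : Fin n` forces `n ≥ 1`.
* `C.output = inr m` and the gate `g = C.gates[m]` is in `acBasis`: the PREFIX program
  `C.gates.take (m + 1)` with output wire `inr m` is a circuit over `acBasis` (gates of index `< m` by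
  the hypothesis, gate `m` by assumption) of size `m + 1 ≤ size C` computing `C` with the same
  `acDepth` (values and depths of a prefix are prefixes of the values and depths:
  `wireOf_vals_append`, `wireDepthOf_wdepths_append`); again `C(x) = [1 ≤ 1 · C(x)]`.
* `C.output = inr m` and `g ∉ acBasis`: then `m + 1 = |C.gates|` (otherwise the hypothesis puts `g` in
  `acBasis`), `g ∈ tcBasis ∖ {¬}` is a threshold `[θ ≤ c · #ones]` of its arguments
  (`exists_threshold_of_mem_tcBasis`: `∧ₖ = [k ≤ #1]`, `∨ₖ = [1 ≤ #1]`, `MAJₖ = [k ≤ 2 · #1]`), and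
  `#ones = Σ_u mult(u) · [u]` over the finite set `U` of DISTINCT argument wires of `g`
  (`numOnes_comp_eq_wsum`), `#U ≤ n + m ≤ size C + n`. Each `u ∈ U` is an input or a gate of index
  `< m`, and is computed by the prefix program `C.gates.take m` (all in `acBasis`) with output wire
  `u`: size `m ≤ size C`, `acDepth = depth(u) ≤ acWeight g + max_a depth(g.args a) = acDepth C`.
  Weights `w_u = c · mult(u)`, threshold `θ`, cast to `ℝ` (`Nat.cast_le`).

The prefix circuits are built with the tree's `GateList.toCircuit`; no new definitions.
-/

set_option linter.dupNamespace false -- D-0017: single-problem summit ⇒ `QuantumAdvantage.QuantumAdvantage` by design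

noncomputable section

namespace Summit.QuantumAdvantage.QuantumAdvantage.Theorems.LiouvilleOrthogonalTC0

open Finset
open Literature.Computability.Complexity
open Literature.Computability.Complexity.GateList

namespace StubMajTop

variable {n : ℕ}

/-! ### Prefix programs -/

/-- Wires into the first `t` gates keep their value in the prefix program `gs.take t`. -/
theorem wireOf_vals_take {ι : Type*} (gs : List (Gate ι)) {t : ℕ} (ht : t ≤ gs.length)
    (x : ι → Bool) (u : ι ⊕ ℕ) (hu : OutOK t u) :
    wireOf x (vals (gs.take t) x) u = wireOf x (vals gs x) u := by
  have h := wireOf_vals_append (gs.take t) (gs.drop t) x u (fun m hm => by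
    have := hu m hm
    rw [List.length_take]; omega)
  rw [List.take_append_drop] at h
  exact h.symm

/-- Wires into the first `t` gates keep their weighted depth in the prefix program `gs.take t`. -/
theorem wireDepthOf_wdepths_take {ι : Type*} (w : GateFn → ℕ) (gs : List (Gate ι)) {t : ℕ}
    (ht : t ≤ gs.length) (u : ι ⊕ ℕ) (hu : OutOK t u) :
    wireDepthOf (wdepths w (gs.take t)) u = wireDepthOf (wdepths w gs) u := by
  have h := wireDepthOf_wdepths_append w (gs.take t) (gs.drop t) u (fun m hm => by
    have := hu m hm
    rw [List.length_take]; omega)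
  rw [List.take_append_drop] at h
  exact h.symm

/-- **Prefix circuits.** The first `t` gates of `C` together with an output wire `u` into them form a
circuit of size `t` whose value and `acDepth` are those of the wire `u` in the prefix program; it is
over `acBasis` as soon as the gates of index `< t` are. -/
theorem exists_prefix (C : Circuit (Fin n)) (t : ℕ) (ht : t ≤ C.gates.length) (u : Fin n ⊕ ℕ)
    (hu : OutOK t u)
    (hac : ∀ (j : ℕ) (hj : j < C.gates.length), j < t → (C.gates[j]).fn ∈ acBasis) :
    ∃ P : Circuit (Fin n), P.IsOver acBasis ∧ P.size = t ∧
      (∀ x, P.eval x = wireOf x (vals (C.gates.take t) x) u) ∧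
      P.acDepth = wireDepthOf (wdepths acWeight (C.gates.take t)) u := by
  have hlen : (C.gates.take t).length = t := by rw [List.length_take]; omega
  have hwf : WF (C.gates.take t) := by
    have h := wf_gates C
    rw [← List.take_append_drop t C.gates] at h
    exact h.of_append_left
  refine ⟨toCircuit (C.gates.take t) u hwf (fun m hm => hlen.symm ▸ hu m hm), ?_, hlen, fun x => ?_, ?_⟩
  · intro g hg
    change g ∈ C.gates.take t at hg
    obtain ⟨j, hj, rfl⟩ := List.mem_iff_getElem.1 hg
    rw [List.getElem_take]
    rw [hlen] at hj
    exact hac j (by omega) hj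
  · exact circuit_eval _ x
  · exact circuit_depthWith _ _

/-! ### The case of a single sub-circuit -/

/-- `[1 ≤ 1 · b] = b`. -/
theorem decide_one_le_ite (b : Bool) : decide ((1 : ℝ) ≤ (if b then (1 : ℝ) else 0)) = b := by
  cases b <;> simp

/-- One circuit `P` over `acBasis` computing `C` with no larger `acDepth` and size gives the
conclusion of `stub_majTop` with `K = 1`, `w = 1`, `θ = 1`, `b = false`. -/
theorem of_single (C P : Circuit (Fin n)) (hP : P.IsOver acBasis) (hd : P.acDepth ≤ C.acDepth)
    (hs : P.size ≤ C.size) (h1 : 1 ≤ C.size + n) (hev : ∀ x, P.eval x = C.eval x) :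
    ∃ (K : ℕ) (Cs : Fin K → Circuit (Fin n)) (w : Fin K → ℝ) (θ : ℝ) (b : Bool),
      K ≤ C.size + n ∧ (∀ a, (Cs a).IsOver acBasis ∧ (Cs a).acDepth ≤ C.acDepth ∧ (Cs a).size ≤ C.size) ∧
      ∀ x : Fin n → Bool, C.eval x =
        xor b (decide (θ ≤ ∑ a, w a * (if (Cs a).eval x then (1 : ℝ) else 0))) := by
  refine ⟨1, fun _ => P, fun _ => 1, 1, false, h1, fun _ => ⟨hP, hd, hs⟩, fun x => ?_⟩
  rw [Fin.sum_univ_one, one_mul, hev x, Bool.false_xor, decide_one_le_ite]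

/-! ### The distinct argument wires of a gate -/

/-- The distinct argument wires of gate `m` of `C` are inputs or gates of index `< m`: there are at
most `n + m` of them. -/
theorem card_image_args_le (C : Circuit (Fin n)) {m : ℕ} (hm : m < C.gates.length) :
    ((univ : Finset (Fin (C.gates[m]).arity)).image (C.gates[m]).args).card ≤ n + m := by
  classical
  have hsub : (univ : Finset (Fin (C.gates[m]).arity)).image (C.gates[m]).args ⊆
      (univ : Finset (Fin n)).image Sum.inl ∪ (range m).image Sum.inr := by
    intro u hu
    obtain ⟨a, -, rfl⟩ := mem_image.1 hu
    cases hga : (C.gates[m]).args a with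
    | inl i => exact mem_union_left _ (mem_image_of_mem _ (mem_univ i))
    | inr m' => exact mem_union_right _ (mem_image_of_mem _ (mem_range.2 (C.wf m hm a m' hga)))
  calc ((univ : Finset (Fin (C.gates[m]).arity)).image (C.gates[m]).args).card
      ≤ ((univ : Finset (Fin n)).image Sum.inl ∪ (range m).image Sum.inr).card := card_le_card hsub
    _ ≤ ((univ : Finset (Fin n)).image Sum.inl).card + ((range m).image Sum.inr).card :=
        card_union_le _ _
    _ ≤ (univ : Finset (Fin n)).card + (range m).card := Nat.add_le_add card_image_le card_image_le
    _ = n + m := by rw [card_univ, Fintype.card_fin, card_range]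

/-- `#ones` as a real sum of indicators: `Σ_u mult(u) · [y u]`. -/
theorem cast_numOnes_comp {k : ℕ} {σ : Type*} [Fintype σ] [DecidableEq σ] (src : Fin k → σ)
    (y : σ → Bool) :
    ((GateFn.numOnes (fun a => y (src a)) : ℕ) : ℝ) =
      ∑ u, ((univ.filter fun a => src a = u).card : ℝ) * (if y u then (1 : ℝ) else 0) := by
  rw [numOnes_comp_eq_wsum src y]
  push_cast
  refine Finset.sum_congr rfl fun u _ => ?_
  cases y u <;> simp

end StubMajTop

open StubMajTop in
/-- **Stub T5 (wave 4, v11) — a single majority gate at the top, syntactically.** A circuit over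
`tcBasis` all of whose gates except possibly the last are `∧/∨/¬` computes `b ⊕ [θ ≤ Σ_a w_a C_a(x)]`
for at most `size + n` circuits `C_a` over `acBasis` (the distinct argument wires of the output gate,
with multiplicities as weights; or the circuit itself when its output is an `acBasis` gate or an input)
of no larger `acDepth` and size. -/
theorem stub_majTop {n : ℕ} (C : Circuit (Fin n)) (hB : C.IsOver tcBasis)
    (hlow : ∀ (j : ℕ) (hj : j + 1 < C.gates.length), (C.gates[j]).fn ∈ acBasis) :
    ∃ (K : ℕ) (Cs : Fin K → Circuit (Fin n)) (w : Fin K → ℝ) (θ : ℝ) (b : Bool),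
      K ≤ C.size + n ∧ (∀ a, (Cs a).IsOver acBasis ∧ (Cs a).acDepth ≤ C.acDepth ∧ (Cs a).size ≤ C.size) ∧
      ∀ x : Fin n → Bool, C.eval x = xor b (decide (θ ≤ ∑ a, w a * (if (Cs a).eval x then (1 : ℝ) else 0))) := by
  classical
  rcases hCo : C.output with i | m
  · -- (a) the output is an input wire
    refine of_single C (Circuit.input i) (fun g hg => by simp [Circuit.input] at hg)
      (Nat.zero_le _) (Nat.zero_le _) (by have := Fin.pos i; omega) fun x => ?_
    rw [Circuit.eval_input, circuit_eval, hCo, wireOf_inl]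
  · have hm : m < C.gates.length := C.wf_output m hCo
    have hsize : C.size = C.gates.length := rfl
    by_cases hgac : (C.gates[m]).fn ∈ acBasis
    · -- (b) the output gate is in `acBasis`: the prefix circuit of its first `m + 1` gates
      have hOK : OutOK (m + 1) (.inr m : Fin n ⊕ ℕ) := fun m' h => by cases h; omega
      obtain ⟨P, hP, hsz, hev, hdep⟩ := exists_prefix C (m + 1) hm (.inr m) hOK fun j hj hjt => by
        rcases Nat.lt_succ_iff_lt_or_eq.1 hjt with hlt | rfl
        · exact hlow j (by omega)
        · exact hgac
      refine of_single C P hP (le_of_eq ?_) (by omega) (by omega) fun x => ?_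
      · rw [hdep, wireDepthOf_wdepths_take acWeight C.gates hm _ hOK, Circuit.acDepth,
          circuit_depthWith, hCo]
      · rw [hev x, wireOf_vals_take C.gates hm x _ hOK, circuit_eval, hCo]
    · -- (c) the output gate is the last gate and a threshold of its arguments
      have hlast : m + 1 = C.gates.length := by
        by_contra hne
        exact hgac (hlow m (by omega))
      have hgB : (C.gates[m]).fn ∈ tcBasis := hB _ (List.getElem_mem hm)
      have hne : (C.gates[m]).fn ≠ GateFn.not := fun h => hgac (h ▸ mem_acBasis_not)
      obtain ⟨θ, c, -, hthr⟩ := exists_threshold_of_mem_tcBasis hgB hne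
      -- splitting off the last gate
      have hsplit : C.gates.take m ++ [C.gates[m]] = C.gates := by
        rw [List.take_append_getElem hm, List.take_of_length_le (by omega)]
      have hlen : (C.gates.take m).length = m := by rw [List.length_take]; omega
      have hval : ∀ x : Fin n → Bool, C.eval x =
          (C.gates[m]).op (fun a => wireOf x (vals (C.gates.take m) x) ((C.gates[m]).args a)) := by
        intro x
        have h := getD_vals_append_singleton (C.gates.take m) (C.gates[m]) x
        rw [hsplit, hlen] at h
        rw [circuit_eval, hCo, wireOf_inr, h]
      have hdepC : C.acDepth = acWeight (C.gates[m]).fn +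
          univ.sup fun a => wireDepthOf (wdepths acWeight (C.gates.take m)) ((C.gates[m]).args a) := by
        have h := getD_wdepths_append_singleton acWeight (C.gates.take m) (C.gates[m])
        rw [hsplit, hlen] at h
        rw [Circuit.acDepth, circuit_depthWith, hCo, wireDepthOf_inr, h]
      have hargs : ∀ a : Fin (C.gates[m]).arity, OutOK m ((C.gates[m]).args a) :=
        fun a m' h => C.wf m hm a m' h
      -- the distinct argument wires
      have hKle : ((univ : Finset (Fin (C.gates[m]).arity)).image (C.gates[m]).args).card ≤
          C.size + n := by
        have := card_image_args_le C hm
        rw [hsize]; omega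
      set U : Finset (Fin n ⊕ ℕ) := (univ : Finset (Fin (C.gates[m]).arity)).image (C.gates[m]).args
        with hU
      have hUOK : ∀ u : {u // u ∈ U}, OutOK m u.1 := by
        rintro ⟨u, hu⟩
        obtain ⟨a, -, rfl⟩ := mem_image.1 hu
        exact hargs a
      -- one prefix circuit per distinct argument wire
      have hP : ∀ u : {u // u ∈ U}, ∃ P : Circuit (Fin n), P.IsOver acBasis ∧ P.size = m ∧
          (∀ x, P.eval x = wireOf x (vals (C.gates.take m) x) u.1) ∧
          P.acDepth = wireDepthOf (wdepths acWeight (C.gates.take m)) u.1 := fun u =>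
        exists_prefix C m hm.le u.1 (hUOK u) fun j hj hjm => hlow j (by omega)
      choose P hP using hP
      set K : ℕ := U.card with hK
      set e : Fin K ≃ {u // u ∈ U} := U.equivFin.symm with he
      set src : Fin (C.gates[m]).arity → {u // u ∈ U} :=
        fun a => ⟨(C.gates[m]).args a, mem_image_of_mem _ (mem_univ a)⟩ with hsrc
      refine ⟨K, fun a => P (e a),
        fun a => (c : ℝ) * ((univ.filter fun a' => src a' = e a).card : ℝ), (θ : ℝ), false,
        hKle, fun a => ⟨(hP (e a)).1, ?_, ?_⟩, fun x => ?_⟩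
      · -- depth
        rw [(hP (e a)).2.2.2, hdepC]
        obtain ⟨a', -, ha'⟩ := mem_image.1 (e a).2
        rw [← ha']
        exact le_add_left (Finset.le_sup (f := fun a' =>
          wireDepthOf (wdepths acWeight (C.gates.take m)) ((C.gates[m]).args a')) (mem_univ a'))
      · -- size
        rw [(hP (e a)).2.1, hsize]; omega
      · -- the threshold identity
        set y : {u // u ∈ U} → Bool := fun u => wireOf x (vals (C.gates.take m) x) u.1 with hy
        have hfun : (fun a => wireOf x (vals (C.gates.take m) x) ((C.gates[m]).args a)) =
            fun a => y (src a) := rfl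
        have hsum : ∑ a : Fin K, (c : ℝ) * ((univ.filter fun a' => src a' = e a).card : ℝ) *
              (if (P (e a)).eval x then (1 : ℝ) else 0) =
            (c : ℝ) * (GateFn.numOnes (fun a => y (src a)) : ℝ) := by
          rw [cast_numOnes_comp src y, Finset.mul_sum]
          refine Fintype.sum_equiv e _ _ fun a => ?_
          rw [(hP (e a)).2.2.1 x, mul_assoc]
        have hthr' : ∀ v : Fin (C.gates[m]).arity → Bool,
            (C.gates[m]).op v = decide (θ ≤ c * GateFn.numOnes v) := hthr
        rw [hval x, hthr', hfun, Bool.false_xor, hsum]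
        simp only [decide_eq_decide]
        exact_mod_cast Iff.rfl

end Summit.QuantumAdvantage.QuantumAdvantage.Theorems.LiouvilleOrthogonalTC0

end
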